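import Summits.CriticalPhenomena.PercolationContinuityZ3.Theorems.PercNearOneGluingNoHeavyLowerTailFKExactEval
import Summits.CriticalPhenomena.PercolationContinuityZ3.Theorems.PercNearOneGluingNoHeavyConstsCrossReachMeasureRefutation
import Summits.CriticalPhenomena.PercolationContinuityZ3.Theorems.PercNearOneGluingNoHeavyConstsMDLXJoint
import HarnessLib

/-!
# "MDL(X)″" — MDL(∅) for the source-and-marker-repelled measure `μ(·|{s,y}↮X)` — is FALSE: an exact six-vertex counterexample
# (PAPER-2 track (ii); seat `prim-consts-2`, gen 20)

builds on p205010 (kernel theorem, internal audit signed; external expert review pending).  Support file (`--supports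
stmt-CriticalPhenomena-4575`); evidence `CEX-RepelledMDL-g20.md` on stmt-4575; memo `run/shared/lean/prim/consts/FROM-prim-consts-2-g20-AVOID-SPLIT.md` §0(2).
Every number below is an exact rational decided by the KERNEL (`decide +kernel` over the `2⁸` configurations of the listed pairs; no `native_decide`);
no definitions of mathematical content, no named facts, no sorries.

THE STATEMENT.  `…ConstsMDLXJointAvoidSplit.lean` splits the MDL(X)′ margin (`Consts.MDLXJoint`) along `{y↮X}`; its first block is the MDL(X)′ margin with
the conditioning `D = {s↮X}` replaced by `E₁ = {s↮X} ∩ {y↮X}`:  `M₁ = μ(T)·[μ(E₁)∫_{E₁∩Z}F − (∫_{E₁}F)μ(E₁∩Z)] − μ(T∩W)·[μ(E₁)∫_{E₁∩Y}F − (∫_{E₁}F)μ(E₁∩Y)]`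
(`T = {y↮{s}∪X}∩{s↮X}`, `W = {y↔z}`, `Z = {s↔z}`, `Y = {s↔y}`), i.e. MDL(∅) for the measure `μ(·|{s,y}↮X)` with that measure's own constant
`P(y↔z | s↮y)`.  It is exactly tight at the marker-pair cylinder in every graph and its Harris half is a theorem (vdBHK Thm 1.3 with sets), which made
`M₁ ≥ 0` a natural candidate — but it is FALSE:
THE WITNESS: `V = Fin 6`, `s = 0`, `y = 4`, `z = 2`, `X = {3}`; pairs `01, 02, 13, 15, 24, 25, 35, 45` with weights
`1023/1024, 31/32, 1023/1024, 1/2, 15/16, 3/4, 63/64, 63/64`; `F = 1{s(0,1) ∈ C_s}`.  With all masses over `2⁴⁴`: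
`μ(E₁) = 502687552`, `∫_{E₁}F = 301364547`, `μ(E₁∩Z) = 490522703`, `∫_{E₁∩Z}F = 295868991`, `μ(E₁∩Y) = 480174159`, `∫_{E₁∩Y}F = 291680829`,
`μ(T) = 22513393`, `μ(T∩W) = 11184177`, and `M₁ = −17147418107483989413/2¹²⁶ ≈ −2.0·10⁻¹⁹ < 0` (ratio `min_U Cov_ρ(U,Z)/Cov_ρ(U,Y) = 0.9488·p'`,
a 5 % violation; `Consts.MDLXJoint` holds there with ratio 1.354).  Mechanism: frustration (g11 `Consts.ThreeSepCex`) — under the three-way separation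
`s|y|X` the clusters of `s` and `y` are positively correlated here.  Two independent exact engines agree (seat gen 20: engines/rho.py, kit/i13/core.py).
* `Consts.RepelledMDLCex.m1_lt` — the margin is negative at the witness;
* `Consts.not_mdlRepelled` — the universally quantified statement (binder style of `Consts.MDLXJoint`) is false.
METHOD: as in `…ConstsMarkerSplitRefutation.lean` (`FK.RCEval` at `q = 1`, Boolean event predicates, `decide +kernel`).
[cite: VandenbergHaggstromKahn2005, Thm. 1.3 (p. 6); §2.1 pp. 9–13] [cite: Grimmett2006, §1.4 eq. (1.20) (p. 15)]
-/

namespace Summit.CriticalPhenomena.PercolationContinuityZ3.Theorems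

namespace Consts

open MeasureTheory Literature.Probability.LatticeModels Literature.Probability.Percolation

namespace RepelledMDLCex

/-- The witness: six vertices, pairs `01,02,13,15,24,25,35,45`, weights `1023/1024,31/32,1023/1024,1/2,15/16,3/4,63/64,63/64`, `q = 1`. -/
abbrev G : FK.RCEval :=
  ⟨6, 8, ![0, 0, 1, 1, 2, 2, 3, 4], ![1, 2, 3, 5, 4, 5, 5, 5], ![1023 / 1024, 31 / 32, 1023 / 1024, 1 / 2, 15 / 16, 3 / 4, 63 / 64, 63 / 64], 1⟩

/-- The listing is valid. [folklore] -/
theorem G_valid : G.Valid := by decide +kernel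

/-- `Σ_t [P t] · ∏_i (c_i or 1 − c_i)` (computable, no cluster count). [folklore] -/
def massW (P : Finset (Fin 8) → Bool) : ℚ := ∑ t : Finset (Fin 8), if P t then G.wQ t else 0

/-- At `q = 1`, `massQ = massW`. [folklore] -/
theorem massQ_eq_massW (P : Finset (Fin 8) → Bool) : G.massQ P = massW P := by
  unfold FK.RCEval.massQ massW FK.RCEval.mQ
  refine Finset.sum_congr rfl fun t _ => ?_
  have hq : G.q = 1 := rfl
  rw [hq, one_pow, mul_one]

/-- At `q = 1`, `ZQ = Σ_t wQ t`. [folklore] -/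
theorem zq_eq : G.ZQ = massW (fun _ => true) := by
  unfold FK.RCEval.ZQ massW FK.RCEval.mQ
  refine Finset.sum_congr rfl fun t _ => ?_
  have hq : G.q = 1 := rfl
  rw [hq, one_pow, mul_one, if_pos rfl]

/-- the pair `01` (index `0`) is open -/
def pO (t : Finset (Fin 8)) : Bool := decide ((0 : Fin 8) ∈ t)
/-- `E₁ = {0 ↮ 3} ∩ {4 ↮ 3}` -/
def pE (t : Finset (Fin 8)) : Bool := !G.reachB t 0 3 && !G.reachB t 4 3
/-- `E₁ ∩ O` -/
def pEO (t : Finset (Fin 8)) : Bool := pE t && pO t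
/-- `E₁ ∩ Z` -/
def pEZ (t : Finset (Fin 8)) : Bool := pE t && G.reachB t 0 2
/-- `E₁ ∩ Z ∩ O` -/
def pEZO (t : Finset (Fin 8)) : Bool := (pE t && G.reachB t 0 2) && pO t
/-- `E₁ ∩ Y` -/
def pEY (t : Finset (Fin 8)) : Bool := pE t && G.reachB t 0 4
/-- `E₁ ∩ Y ∩ O` -/
def pEYO (t : Finset (Fin 8)) : Bool := (pE t && G.reachB t 0 4) && pO t
/-- `T = {4 ↮ 0, 4 ↮ 3} ∩ {0 ↮ 3}` -/
def pT (t : Finset (Fin 8)) : Bool := (!G.reachB t 4 0 && !G.reachB t 4 3) && !G.reachB t 0 3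
/-- `T ∩ W` -/
def pTW (t : Finset (Fin 8)) : Bool := ((!G.reachB t 4 0 && !G.reachB t 4 3) && !G.reachB t 0 3) && G.reachB t 4 2

/-! ### Kernel arithmetic (`decide +kernel`, `2⁸` configurations each) -/

set_option maxHeartbeats 0 in
/-- `Z = 1`. [folklore] -/
theorem massW_true : massW (fun _ => true) = 1 := by decide +kernel
set_option maxHeartbeats 0 in
/-- mass of `E₁`. -/
theorem mass_E : massW pE = 502687552 / 17592186044416 := by decide +kernel
set_option maxHeartbeats 0 in
/-- mass of `E₁ ∩ O`. -/
theorem mass_EO : massW pEO = 301364547 / 17592186044416 := by decide +kernel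
set_option maxHeartbeats 0 in
/-- mass of `E₁ ∩ Z`. -/
theorem mass_EZ : massW pEZ = 490522703 / 17592186044416 := by decide +kernel
set_option maxHeartbeats 0 in
/-- mass of `E₁ ∩ Z ∩ O`. -/
theorem mass_EZO : massW pEZO = 295868991 / 17592186044416 := by decide +kernel
set_option maxHeartbeats 0 in
/-- mass of `E₁ ∩ Y`. -/
theorem mass_EY : massW pEY = 480174159 / 17592186044416 := by decide +kernel
set_option maxHeartbeats 0 in
/-- mass of `E₁ ∩ Y ∩ O`. -/
theorem mass_EYO : massW pEYO = 291680829 / 17592186044416 := by decide +kernel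
set_option maxHeartbeats 0 in
/-- mass of `T`. -/
theorem mass_T : massW pT = 22513393 / 17592186044416 := by decide +kernel
set_option maxHeartbeats 0 in
/-- mass of `T ∩ W`. -/
theorem mass_TW : massW pTW = 11184177 / 17592186044416 := by decide +kernel

/-! ### From Booleans to the events of the statement -/

/-- Reachability in the listed configuration as a Boolean. [folklore] -/
theorem reach_iff (t : Finset (Fin 8)) (a b : Fin 6) :
    (openGraph (V := Fin 6) (G.conf t)).Reachable a b ↔ G.reachB t a b = true :=
  (FK.RCEval.reachB_iff (D := G) t a b).symm

/-- The pair `01` is open in the listed configuration iff its index `0` is selected. [folklore] -/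
theorem open01_iff' (t : Finset (Fin 8)) : s((0 : Fin 6), (1 : Fin 6)) ∈ G.conf t ↔ pO t = true := by
  unfold pO FK.RCEval.conf
  rw [Finset.mem_coe, Finset.mem_image, decide_eq_true_iff]
  constructor
  · rintro ⟨i, hi, he⟩
    have key : ∀ j : Fin 8, G.edge j = s((0 : Fin 6), (1 : Fin 6)) → j = 0 := by decide
    rw [← key i he]; exact hi
  · intro h; exact ⟨0, h, by decide⟩

-- the sets of the instantiated statement (`s = 0`, `y = 4`, `z = 2`, `X = {3}`)
/-- `D = {0 ↮ 3}`. -/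
abbrev sD : Set (BondConfig (Fin 6)) := {ω | ∀ x ∈ ({3} : Set (Fin 6)), ¬ (openGraph ω).Reachable 0 x}
/-- `A = {4 ↮ 3}`. -/
abbrev sA : Set (BondConfig (Fin 6)) := {ω | ∀ x ∈ ({3} : Set (Fin 6)), ¬ (openGraph ω).Reachable 4 x}
/-- `{4 ↮ {0,3}}`. -/
abbrev sT : Set (BondConfig (Fin 6)) := {ω | ∀ x ∈ insert (0 : Fin 6) ({3} : Set (Fin 6)), ¬ (openGraph ω).Reachable 4 x}
/-- `O = {01 open}`. -/
abbrev sO : Set (BondConfig (Fin 6)) := {ω | s((0 : Fin 6), (1 : Fin 6)) ∈ ω}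

/-- Membership in `D`. [folklore] -/
theorem mem_D_iff (ω : BondConfig (Fin 6)) : ω ∈ sD ↔ ¬ (openGraph ω).Reachable 0 3 := by
  simp only [Set.mem_setOf_eq, Set.mem_singleton_iff, forall_eq]
/-- Membership in `A`. [folklore] -/
theorem mem_A_iff (ω : BondConfig (Fin 6)) : ω ∈ sA ↔ ¬ (openGraph ω).Reachable 4 3 := by
  simp only [Set.mem_setOf_eq, Set.mem_singleton_iff, forall_eq]
/-- Membership in `{4 ↮ {0,3}}`. [folklore] -/
theorem mem_T_iff (ω : BondConfig (Fin 6)) : ω ∈ sT ↔ ¬ (openGraph ω).Reachable 4 0 ∧ ¬ (openGraph ω).Reachable 4 3 := by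
  simp only [Set.mem_setOf_eq, Set.mem_insert_iff, Set.mem_singleton_iff, forall_eq_or_imp, forall_eq]

/-- Membership in `E₁` read by `pE`. [folklore] -/
theorem mem_E (t : Finset (Fin 8)) : G.conf t ∈ (sD ∩ sA) ↔ pE t = true := by
  rw [Set.mem_inter_iff, mem_D_iff, mem_A_iff, CrossReachMeasureCex.not_iff_bnot (reach_iff t 0 3),
    CrossReachMeasureCex.not_iff_bnot (reach_iff t 4 3)]
  unfold pE; rw [Bool.and_eq_true]
/-- Membership in `O` read by `pO`. [folklore] -/
theorem open01_iff (t : Finset (Fin 8)) : G.conf t ∈ sO ↔ pO t = true := by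
  rw [Set.mem_setOf_eq]; exact open01_iff' t
/-- Membership in `E₁ ∩ O`. -/
theorem mem_EO (t : Finset (Fin 8)) : G.conf t ∈ (sD ∩ sA ∩ sO) ↔ pEO t = true := by
  rw [Set.mem_inter_iff, mem_E, open01_iff]; unfold pEO; rw [Bool.and_eq_true]
/-- Membership in `E₁ ∩ Z`. -/
theorem mem_EZ (t : Finset (Fin 8)) : G.conf t ∈ (sD ∩ sA ∩ openConn 0 2) ↔ pEZ t = true := by
  rw [Set.mem_inter_iff, mem_E]; unfold pEZ openConn; rw [Set.mem_setOf_eq, reach_iff, Bool.and_eq_true]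
/-- Membership in `E₁ ∩ Z ∩ O`. -/
theorem mem_EZO (t : Finset (Fin 8)) : G.conf t ∈ (sD ∩ sA ∩ openConn 0 2 ∩ sO) ↔ pEZO t = true := by
  rw [Set.mem_inter_iff, mem_EZ, open01_iff]; unfold pEZO; rw [Bool.and_eq_true]; rfl
/-- Membership in `E₁ ∩ Y`. -/
theorem mem_EY (t : Finset (Fin 8)) : G.conf t ∈ (sD ∩ sA ∩ openConn 0 4) ↔ pEY t = true := by
  rw [Set.mem_inter_iff, mem_E]; unfold pEY openConn; rw [Set.mem_setOf_eq, reach_iff, Bool.and_eq_true]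
/-- Membership in `E₁ ∩ Y ∩ O`. -/
theorem mem_EYO (t : Finset (Fin 8)) : G.conf t ∈ (sD ∩ sA ∩ openConn 0 4 ∩ sO) ↔ pEYO t = true := by
  rw [Set.mem_inter_iff, mem_EY, open01_iff]; unfold pEYO; rw [Bool.and_eq_true]; rfl
/-- Membership in `T`. -/
theorem mem_T (t : Finset (Fin 8)) : G.conf t ∈ (sT ∩ sD) ↔ pT t = true := by
  rw [Set.mem_inter_iff, mem_T_iff, mem_D_iff, CrossReachMeasureCex.not_iff_bnot (reach_iff t 4 0),
    CrossReachMeasureCex.not_iff_bnot (reach_iff t 4 3), CrossReachMeasureCex.not_iff_bnot (reach_iff t 0 3)]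
  unfold pT; rw [Bool.and_eq_true, Bool.and_eq_true]
/-- Membership in `T ∩ W`. -/
theorem mem_TW (t : Finset (Fin 8)) : G.conf t ∈ (sT ∩ sD ∩ openConn 4 2) ↔ pTW t = true := by
  rw [Set.mem_inter_iff, mem_T]; unfold pTW openConn; rw [Set.mem_setOf_eq, reach_iff, Bool.and_eq_true]; rfl

/-! ### The eight masses as real numbers -/

/-- At `q = 1` the random-cluster measure of the listing is the Bernoulli product measure. [cite: Grimmett2006, §1.3] -/
theorem rc_eq : rcMeasureW G.w ((G.q : ℚ) : ℝ) ∅ = prodBernoulli G.w := by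
  have : ((G.q : ℚ) : ℝ) = 1 := by norm_num [G]
  rw [this]; exact rcMeasureW_one G.w ∅

/-- `μ(E₁)` exactly. -/
theorem real_E : (prodBernoulli G.w).real (sD ∩ sA) = ((502687552 / 17592186044416 : ℚ) : ℝ) := by
  have h := FK.RCEval.real_eq_massQ_div G_valid (mem_E)
  rw [rc_eq, massQ_eq_massW, mass_E, zq_eq, massW_true, div_one] at h; exact h
/-- `μ(E₁ ∩ O)` exactly. -/
theorem real_EO : (prodBernoulli G.w).real (sD ∩ sA ∩ sO) = ((301364547 / 17592186044416 : ℚ) : ℝ) := by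
  have h := FK.RCEval.real_eq_massQ_div G_valid (mem_EO)
  rw [rc_eq, massQ_eq_massW, mass_EO, zq_eq, massW_true, div_one] at h; exact h
/-- `μ(E₁ ∩ Z)` exactly. -/
theorem real_EZ : (prodBernoulli G.w).real (sD ∩ sA ∩ openConn 0 2) = ((490522703 / 17592186044416 : ℚ) : ℝ) := by
  have h := FK.RCEval.real_eq_massQ_div G_valid (mem_EZ)
  rw [rc_eq, massQ_eq_massW, mass_EZ, zq_eq, massW_true, div_one] at h; exact h
/-- `μ(E₁ ∩ Z ∩ O)` exactly. -/
theorem real_EZO : (prodBernoulli G.w).real (sD ∩ sA ∩ openConn 0 2 ∩ sO) = ((295868991 / 17592186044416 : ℚ) : ℝ) := by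
  have h := FK.RCEval.real_eq_massQ_div G_valid (mem_EZO)
  rw [rc_eq, massQ_eq_massW, mass_EZO, zq_eq, massW_true, div_one] at h; exact h
/-- `μ(E₁ ∩ Y)` exactly. -/
theorem real_EY : (prodBernoulli G.w).real (sD ∩ sA ∩ openConn 0 4) = ((480174159 / 17592186044416 : ℚ) : ℝ) := by
  have h := FK.RCEval.real_eq_massQ_div G_valid (mem_EY)
  rw [rc_eq, massQ_eq_massW, mass_EY, zq_eq, massW_true, div_one] at h; exact h
/-- `μ(E₁ ∩ Y ∩ O)` exactly. -/
theorem real_EYO : (prodBernoulli G.w).real (sD ∩ sA ∩ openConn 0 4 ∩ sO) = ((291680829 / 17592186044416 : ℚ) : ℝ) := by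
  have h := FK.RCEval.real_eq_massQ_div G_valid (mem_EYO)
  rw [rc_eq, massQ_eq_massW, mass_EYO, zq_eq, massW_true, div_one] at h; exact h
/-- `μ(T)` exactly. -/
theorem real_T : (prodBernoulli G.w).real (sT ∩ sD) = ((22513393 / 17592186044416 : ℚ) : ℝ) := by
  have h := FK.RCEval.real_eq_massQ_div G_valid (mem_T)
  rw [rc_eq, massQ_eq_massW, mass_T, zq_eq, massW_true, div_one] at h; exact h
/-- `μ(T ∩ W)` exactly. -/
theorem real_TW : (prodBernoulli G.w).real (sT ∩ sD ∩ openConn 4 2) = ((11184177 / 17592186044416 : ℚ) : ℝ) := by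
  have h := FK.RCEval.real_eq_massQ_div G_valid (mem_TW)
  rw [rc_eq, massQ_eq_massW, mass_TW, zq_eq, massW_true, div_one] at h; exact h

/-! ### The cylinder functional of the pair `01` -/

open scoped Classical in
/-- `F(C) = 1{s(0,1) ∈ C}`: the indicator that the owner's cluster contains the pair `01` (a cylinder functional). -/
noncomputable def F (C : Set (Sym2 (Fin 6))) : ℝ := if s((0 : Fin 6), (1 : Fin 6)) ∈ C then 1 else 0

/-- The cylinder functional is monotone. [folklore] -/
theorem F_mono : Monotone F := by
  intro C C' h; unfold F
  by_cases hc : s((0 : Fin 6), (1 : Fin 6)) ∈ C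
  · rw [if_pos hc, if_pos (h hc)]
  · rw [if_neg hc]; split_ifs <;> norm_num

/-- The pair `01` lies in the open edge cluster of `0` iff it is open. [folklore] -/
theorem mem_cluster_iff (ω : BondConfig (Fin 6)) : s((0 : Fin 6), (1 : Fin 6)) ∈ openEdgeCluster ω 0 ↔ s((0 : Fin 6), (1 : Fin 6)) ∈ ω := by
  rw [mem_openEdgeCluster_iff]
  constructor
  · exact fun h => h.1
  · intro h
    have h01 : (0 : Fin 6) ≠ 1 := by decide
    refine ⟨h, ?_, ?_⟩
    · rw [Sym2.mk_isDiag_iff]; exact h01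
    · intro v hv
      rcases Sym2.mem_iff.1 hv with rfl | rfl
      · exact SimpleGraph.Reachable.refl _
      · have hadj : (openGraph ω).Adj 0 1 := by
          unfold openGraph; rw [SimpleGraph.fromEdgeSet_adj]; exact ⟨h, h01⟩
        exact hadj.reachable

/-- Reading the cylinder functional on a configuration. [folklore] -/
theorem F_cluster (ω : BondConfig (Fin 6)) : F (openEdgeCluster ω 0) = sO.indicator 1 ω := by
  unfold F
  by_cases h : s((0 : Fin 6), (1 : Fin 6)) ∈ ω
  · rw [if_pos ((mem_cluster_iff ω).2 h), Set.indicator_of_mem (show ω ∈ sO from h), Pi.one_apply]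
  · rw [if_neg (fun h' => h ((mem_cluster_iff ω).1 h')), Set.indicator_of_notMem (show ω ∉ sO from h)]

/-- `∫_S F(C_0) = μ(S ∩ O)`. [folklore] -/
theorem integral_F (S : Set (BondConfig (Fin 6))) :
    ∫ ω in S, F (openEdgeCluster ω 0) ∂(prodBernoulli G.w) = (prodBernoulli G.w).real (S ∩ sO) := by
  simp_rw [F_cluster]; exact TripodExchange.setIntegral_indicator_one_eq _ _ _

/-! ### The refutation -/

/-- **MDL(X)″ fails at the witness**: with `μ = prodBernoulli G.w`, `s = 0`, `y = 4`, `z = 2`, `X = {3}`, `F = 1{01 ∈ C}`: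
`μ(T)·[μ(E₁)∫_{E₁∩Z}F − (∫_{E₁}F)μ(E₁∩Z)] − μ(T∩W)·[μ(E₁)∫_{E₁∩Y}F − (∫_{E₁}F)μ(E₁∩Y)] < 0` (value `−17147418107483989413/2¹²⁶`).
(this seat, gen 20; two independent exact engines agree) [cite: VandenbergHaggstromKahn2005, §2.1 pp. 9–13] -/
theorem m1_lt :
    (prodBernoulli G.w).real (sT ∩ sD) *
        ((prodBernoulli G.w).real (sD ∩ sA) * (∫ ω in sD ∩ sA ∩ openConn 0 2, F (openEdgeCluster ω 0) ∂(prodBernoulli G.w)) -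
          (∫ ω in sD ∩ sA, F (openEdgeCluster ω 0) ∂(prodBernoulli G.w)) * (prodBernoulli G.w).real (sD ∩ sA ∩ openConn 0 2)) -
      (prodBernoulli G.w).real (sT ∩ sD ∩ openConn 4 2) *
        ((prodBernoulli G.w).real (sD ∩ sA) * (∫ ω in sD ∩ sA ∩ openConn 0 4, F (openEdgeCluster ω 0) ∂(prodBernoulli G.w)) -
          (∫ ω in sD ∩ sA, F (openEdgeCluster ω 0) ∂(prodBernoulli G.w)) * (prodBernoulli G.w).real (sD ∩ sA ∩ openConn 0 4)) < 0 := by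
  rw [integral_F, integral_F, integral_F, real_E, real_EO, real_EZ, real_EZO, real_EY, real_EYO, real_T, real_TW]
  norm_num

end RepelledMDLCex

/-- **THEOREM: MDL(∅) does NOT survive conditioning the owner AND the marker on avoiding the set `X` ("MDL(X)″" is false).**  The statement
"for all `n, w, s ≠ y, z, X` and every monotone `F` of `C_s`:  `μ(T∩W)·cov_{E₁}(F;Y) ≤ μ(T)·cov_{E₁}(F;Z)`, `E₁ = {s↮X}∩{y↮X}`" — the first block of
the marker-avoidance split `Consts.mdlx_avoidSplit_identity`, exactly tight at the marker pair in every graph — fails at `n = 6`, `s = 0`, `y = 4`,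
`z = 2`, `X = {3}`, weights as in `Consts.RepelledMDLCex.G`, `F = 1{01 ∈ C_s}` (`Consts.RepelledMDLCex.m1_lt`).  `Consts.MDLXJoint` (conditioning
`{s↮X}` only, same constant `p'`) holds at the witness.  refuted-substantive (5 % violation; 28 further exact witnesses by corner climbs, kit j201437).
[cite: VandenbergHaggstromKahn2005, Thm. 1.3 (p. 6), §2.1 pp. 9–13] -/
theorem not_mdlRepelled : ¬ (∀ (n : ℕ) (w : Sym2 (Fin n) → unitInterval) (s y z : Fin n) (X : Set (Fin n)), s ≠ y →
    ∀ F : Set (Sym2 (Fin n)) → ℝ, Monotone F →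
    (prodBernoulli w).real ({ω : BondConfig (Fin n) | ∀ x ∈ insert s X, ¬ (openGraph ω).Reachable y x} ∩
          {ω | ∀ x ∈ X, ¬ (openGraph ω).Reachable s x} ∩ openConn y z) *
        ((prodBernoulli w).real ({ω : BondConfig (Fin n) | ∀ x ∈ X, ¬ (openGraph ω).Reachable s x} ∩ {ω | ∀ x ∈ X, ¬ (openGraph ω).Reachable y x}) *
            (∫ ω in {ω : BondConfig (Fin n) | ∀ x ∈ X, ¬ (openGraph ω).Reachable s x} ∩ {ω | ∀ x ∈ X, ¬ (openGraph ω).Reachable y x} ∩ openConn s y,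
              F (openEdgeCluster ω s) ∂(prodBernoulli w)) -
          (∫ ω in {ω : BondConfig (Fin n) | ∀ x ∈ X, ¬ (openGraph ω).Reachable s x} ∩ {ω | ∀ x ∈ X, ¬ (openGraph ω).Reachable y x},
              F (openEdgeCluster ω s) ∂(prodBernoulli w)) *
            (prodBernoulli w).real ({ω : BondConfig (Fin n) | ∀ x ∈ X, ¬ (openGraph ω).Reachable s x} ∩ {ω | ∀ x ∈ X, ¬ (openGraph ω).Reachable y x} ∩
              openConn s y)) ≤
      (prodBernoulli w).real ({ω : BondConfig (Fin n) | ∀ x ∈ insert s X, ¬ (openGraph ω).Reachable y x} ∩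
          {ω | ∀ x ∈ X, ¬ (openGraph ω).Reachable s x}) *
        ((prodBernoulli w).real ({ω : BondConfig (Fin n) | ∀ x ∈ X, ¬ (openGraph ω).Reachable s x} ∩ {ω | ∀ x ∈ X, ¬ (openGraph ω).Reachable y x}) *
            (∫ ω in {ω : BondConfig (Fin n) | ∀ x ∈ X, ¬ (openGraph ω).Reachable s x} ∩ {ω | ∀ x ∈ X, ¬ (openGraph ω).Reachable y x} ∩ openConn s z,
              F (openEdgeCluster ω s) ∂(prodBernoulli w)) -
          (∫ ω in {ω : BondConfig (Fin n) | ∀ x ∈ X, ¬ (openGraph ω).Reachable s x} ∩ {ω | ∀ x ∈ X, ¬ (openGraph ω).Reachable y x},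
              F (openEdgeCluster ω s) ∂(prodBernoulli w)) *
            (prodBernoulli w).real ({ω : BondConfig (Fin n) | ∀ x ∈ X, ¬ (openGraph ω).Reachable s x} ∩ {ω | ∀ x ∈ X, ¬ (openGraph ω).Reachable y x} ∩
              openConn s z))) := by
  intro h
  have h6 := h 6 RepelledMDLCex.G.w 0 4 2 {3} (by decide) RepelledMDLCex.F RepelledMDLCex.F_mono
  have hlt := RepelledMDLCex.m1_lt
  exact absurd h6 (not_le.2 (by linarith [hlt]))

end Consts

end Summit.CriticalPhenomena.PercolationContinuityZ3.Theorems
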